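import Summits.QuantumFields.YangMills.Theorems.BalabanUVNodesN19LinkReadingAtU3Pin

/-!
# BalabanUVNodes ∕ N19 — (T)'s DECAY INPUT OF THE N19′ LINK READING AT THE (t-U3) PIN COSTS NOTHING BEYOND THE K4 SLOTS: uniform (1.18)∕(0.25)
# decay on the window FOLLOWS from N22's slot (NE9 ∧ fading memory, `ω < 1`) and (5.10) decay at ONE reference history — i.e. from stub 1's
# displayed (D4) letter `KernelDecayOfRecord₁₃` at every direction pair; with FILE 2's converse, (T)-decay ⟺ (D4)-letter-∀μν modulo N22's slot

Cell `pub-ymgap`, HUMAN RULING D-0062 (Track A) ∕ D-0149 ∕ D-0154 (director-ym R399 (3a), №207 width wave), width seat `pub-ymgap-dag-n19-w5`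
(generation 0 ∕ re-seat g1), FILE 3.  THEOREMS ONLY (0 `def`, 0 `sorry`); imports FILE 2 `BalabanUVNodesN19LinkReadingAtU3Pin` ONLY (v3: the v2 import of
dag-n22's `BalabanUVNodesN22KnitWitness` is dropped again — its one use, «two histories of `]0, γ]` differ by ≤ γ», is a two-line `have`, as in g1's
edition p612489 — so the closure is FILE 2's; `sum_pow_sub_le` stays declared (append-only)); modifies nothing;
`--kind proof --supports` K3⁷ `SpineGivenEndpointR13SepCoPH` (stmt-QuantumFields-20544) `--as helper` — COUNT-NEUTRAL.

WHAT.  FILE 2 showed: at the (t-U3) pin the tube block (T) of the link reading reduces to ONE decay input `DecayBound R.u3.EA (Window γ) E₀T R.u3.κ` (pair discs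
idle, `0 ≤ E₀T` free) and that this input IMPLIES stub 1's displayed (D4) letter `KernelDecayOfRecord₁₃ F N θ μ ν κ` at every `(μ, ν)`.  This file closes the
circle: §1 [folklore, generic `T4OutputRate` vocabulary] a functional with NE9 + fading memory (`0 ≤ ω < 1`, `0 ≤ C₉`) on a window `W ⊆ ]0, γ]^ℕ` that decays at ONE
reference history `g₀ ∈ W` with constant `C₀` decays UNIFORMLY on `W` with constant `C₀ + C₉·γ·ω∕(1 − ω)` (`decayBound_of_refDecay_of_ne9_fading`: triangle
inequality + `|gᵢ − g₀ᵢ| ≤ γ` + the geometric tail `Σ_{1 ≤ j ≤ s} ω^j ≤ ω∕(1 − ω)`); §2 at the pinned bundle `u3OfRecord₁₃ θ (objectsOfRecord₁₃ F N θ ℓ) k`: N22's slot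
`N22At` IS NE9 ∧ fading memory of the pinned functional at the letters `ℓ.κ, ℓ.moduli, ℓ.C₉, ℓ.ω` (`rfl`), and (5.10) decay of the limiting kernels of record at ONE
history of the window at every direction pair (∃ constant per pair, uniform in the level — the (D4) letter's shape AT THAT HISTORY) gives the reference decay with
`C₀ := Σ_{μν} |C₀(μ,ν)|`; hence ★ `decayBound_atPin_of_kernelDecayOfRecord₁₃_of_n22At`: (∀ μ ν, `KernelDecayOfRecord₁₃ F N θ μ ν ℓ.κ`) ∧ `N22At (pinned bundle)` ∧
`0 ≤ ℓ.C₉` ∧ `0 ≤ ℓ.ω < 1` ∧ `0 < θ.γ` ⟹ `∃ E₀ ≥ 0, DecayBound (pinned EA) (Window θ.γ) E₀ ℓ.κ` (and on every tuning window `γ' ≤ θ.γ`); with FILE 2's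
`kernelDecayOfRecord₁₃_of_decayBound`: ★ `decayBound_atPin_iff_kernelDecayOfRecord₁₃` — modulo N22's slot and the letter signs, (T)'s decay input at the pin ⟺ the
(D4) letter at every direction pair.  §3 the same under the pin equation at `(rateCarriersOfRecord₁₃CoPH 𝔯 F θ hP g₀ os k).u3`.

LOCATED (count-neutral).  At the pins NODE O's (T) block asks of the record EXACTLY «(5.10) decay of the limiting kernels at every direction pair» once N22's slot
holds with `ω < 1` — one more reason (after FILE 2) to read the K4 letters and the link reading's (T) block as ONE input in any later edition.

HONEST FRAMING.  Elementary real analysis (triangle inequality, geometric series) over HYPOTHESIS shapes; nothing of Bałaban's asserted; NE9 ∕ (5.10)-at-the-record ∕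
NE7 NOT PRINTED as two-run statements for d = 4 and NOT proved; no stub closed; N19 ∕ N22 NOT discharged; K3⁷ OPEN; counts UNMOVED (28∕28 · 5∕27 · A 5∕28).
One finite 𝕋⁴ at fixed ε — R4 closes the CONDITIONAL rung `BalabanLadder.UV` only; the Yang–Mills mass gap (Clay) is NOT proved by any of this.  [folklore] throughout.
-/

noncomputable section

namespace Summit.QuantumFields.YangMills.BalabanUVNodes.N19TubeDecayAtU3PinFromLetters

open Finset
open scoped BigOperators
open Literature.MathematicalPhysics.QuantumFieldTheory.Balaban1983to89
open Literature.MathematicalPhysics.QuantumFieldTheory.Balaban1983to89.T4Continuum (T4Family ULoop)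
open Literature.MathematicalPhysics.QuantumFieldTheory.Balaban1983to89.T4OutputRate (Carriers Functional Window DecayBound NE9 FadingMemory)
open Literature.MathematicalPhysics.QuantumFieldTheory.Balaban1983to89.Node00 (Stage13Params Stage13HParams U3Letters₁₁)
open Literature.MathematicalPhysics.QuantumFieldTheory.Balaban1983to89.Node00.U3OfKernels (carriers pt bg objectsOfRecord₁₃ KernelDecayOfRecord₁₃
  kernelDecayOfRecord₁₃_iff)
open Literature.MathematicalPhysics.QuantumFieldTheory.Balaban1983to89.B12Sec2to5 (l1)
open YMDAG.UVSplit (U3Carriers RateCarriers RateReading₁₃CoPH N22At u3OfRecord₁₃ rateCarriersOfRecord₁₃CoPH)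
open Summit.QuantumFields.YangMills.BalabanUVNodes.N19LinkReadingAtU3Pin (kernelDecayOfRecord₁₃_of_decayBound decayBound_window_mono window_mono
  u3_rateCarriersOfRecord₁₃CoPH_of_pin)

/-! ## §1 Generic: decay at one reference history + NE9 + fading memory ⟹ uniform decay on the window -/

section Generic

variable {C : Carriers} {Bg : Type} (E : Functional C Bg)

/-- The geometric tail of the history bracket: `Σ_{i < s} ω^{s−i} ≤ ω ∕ (1 − ω)` for `0 ≤ ω < 1`. [folklore] -/
theorem sum_pow_sub_le {ω : ℝ} (hω0 : 0 ≤ ω) (hω1 : ω < 1) (s : ℕ) :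
    ∑ i ∈ range s, ω ^ (s - i) ≤ ω / (1 - ω) := by
  have hrefl : ∑ i ∈ range s, ω ^ (s - i) = ∑ j ∈ range s, ω ^ (j + 1) := by
    rw [← Finset.sum_range_reflect (fun j => ω ^ (j + 1)) s]
    refine Finset.sum_congr rfl fun i hi => ?_
    rw [Finset.mem_range] at hi
    congr 1
    omega
  have hIco : ∑ j ∈ range s, ω ^ (j + 1) = ∑ i ∈ Ico 1 (s + 1), ω ^ i := by
    rw [Finset.sum_Ico_eq_sum_range, Nat.add_sub_cancel]
    exact Finset.sum_congr rfl fun i _ => by rw [add_comm]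
  rw [hrefl, hIco]
  calc ∑ i ∈ Ico 1 (s + 1), ω ^ i ≤ ω ^ 1 / (1 - ω) := geom_sum_Ico_le_of_lt_one hω0 hω1
    _ = ω / (1 - ω) := by rw [pow_one]

/-- **UNIFORM DECAY ON THE WINDOW FROM DECAY AT ONE REFERENCE HISTORY + NE9 + FADING MEMORY** [folklore]: if `E` decays with constant `C₀` at one
`g₀ ∈ W ⊆ ]0, γ]^ℕ`, is jointly history-Lipschitz (NE9) on `W` with moduli `Λ` of fading memory `Λ k i ≤ C₉ ω^{k−i}`, `0 ≤ C₉`, `0 ≤ ω < 1`, then it decays on ALL of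
`W` with the ONE constant `C₀ + C₉·γ·ω∕(1 − ω)` (triangle inequality; the history bracket is `≤ e^{−κd}·C₉·γ·Σ_{i<s} ω^{s−i}`). [folklore] -/
theorem decayBound_of_refDecay_of_ne9_fading {γ κ C₀ C₉ ω : ℝ} {Λ : ℕ → ℕ → ℝ} {W : Set (ℕ → ℝ)} (hW : W ⊆ Window γ) (hγ : 0 ≤ γ)
    {g₀ : ℕ → ℝ} (hg₀ : g₀ ∈ W) (href : ∀ (U : Bg) (X : C.Dom), |E g₀ U X| ≤ C₀ * Real.exp (-(κ * C.d X)))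
    (h9 : NE9 E W κ Λ) (hΛ : FadingMemory C₉ ω Λ) (hC₉ : 0 ≤ C₉) (hω0 : 0 ≤ ω) (hω1 : ω < 1) :
    DecayBound E W (C₀ + C₉ * γ * (ω / (1 - ω))) κ := by
  intro g hg U X
  have he : 0 < Real.exp (-(κ * C.d X)) := Real.exp_pos _
  -- two histories of `]0, γ]^ℕ` differ coordinatewise by at most `γ` (the landed one-liner `N22KnitWitness.abs_sub_le_of_mem_window`, inlined to keep the closure)
  have hdiff : ∀ i, |g i - g₀ i| ≤ γ := fun i => by
    have h1 := hW hg i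
    have h2 := hW hg₀ i
    rw [abs_sub_le_iff]
    constructor <;> linarith [h1.1, h1.2, h2.1, h2.2]
  -- the history bracket at the scale of `X`
  have hbr : ∑ i ∈ range (C.scale X), Λ (C.scale X) i * |g i - g₀ i| ≤ C₉ * γ * (ω / (1 - ω)) := by
    calc ∑ i ∈ range (C.scale X), Λ (C.scale X) i * |g i - g₀ i|
        ≤ ∑ i ∈ range (C.scale X), C₉ * ω ^ (C.scale X - i) * γ := by
          refine Finset.sum_le_sum fun i hi => ?_
          rw [Finset.mem_range] at hi
          exact mul_le_mul (hΛ _ _ hi.le).2 (hdiff i) (abs_nonneg _)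
            (mul_nonneg hC₉ (pow_nonneg hω0 _))
      _ = C₉ * γ * ∑ i ∈ range (C.scale X), ω ^ (C.scale X - i) := by
          rw [Finset.mul_sum]
          exact Finset.sum_congr rfl fun i _ => by ring
      _ ≤ C₉ * γ * (ω / (1 - ω)) := mul_le_mul_of_nonneg_left (sum_pow_sub_le hω0 hω1 _) (mul_nonneg hC₉ hγ)
  have h9' := h9 g hg g₀ hg₀ U X
  calc |E g U X| = |E g₀ U X + (E g U X - E g₀ U X)| := by ring_nf
    _ ≤ |E g₀ U X| + |E g U X - E g₀ U X| := abs_add_le _ _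
    _ ≤ C₀ * Real.exp (-(κ * C.d X)) + Real.exp (-(κ * C.d X)) * (C₉ * γ * (ω / (1 - ω))) :=
        add_le_add (href U X) (h9'.trans (mul_le_mul_of_nonneg_left hbr he.le))
    _ = (C₀ + C₉ * γ * (ω / (1 - ω))) * Real.exp (-(κ * C.d X)) := by ring

end Generic

/-! ## §2 At the pinned bundle: (T)'s decay input from the (D4) letter at every direction pair and N22's slot -/

section AtPin

variable {N : ℕ} [NeZero N] {F : T4Family} (θ : Stage13Params F N) (ℓ : U3Letters₁₁) (k : ℕ)

/-- N22's slot at the pinned bundle IS NE9 ∧ fading memory of the pinned functional at the letters `ℓ.κ, ℓ.moduli, ℓ.C₉, ℓ.ω` on the record window (`Iff.rfl`). [folklore] -/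
theorem n22At_atPin_iff :
    N22At (u3OfRecord₁₃ θ (objectsOfRecord₁₃ F N θ ℓ) k) ↔
      NE9 (u3OfRecord₁₃ θ (objectsOfRecord₁₃ F N θ ℓ) k).EA (Window θ.γ) ℓ.κ ℓ.moduli ∧ FadingMemory ℓ.C₉ ℓ.ω ℓ.moduli :=
  Iff.rfl

/-- **REFERENCE DECAY FROM THE (D4) LETTER's SHAPE AT ONE HISTORY** [bookkeeping]: (5.10) decay of the limiting kernels of record at ONE history `g₀` of the
record window, at EVERY direction pair with a per-pair constant uniform in the level (what `KernelDecayOfRecord₁₃ F N θ μ ν κ` gives at `g₀`), yields decay of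
the pinned run-A functional at `g₀` with the ONE constant `Σ_{μν} |C₀ μ ν|`. [folklore] -/
theorem refDecay_atPin_of_kernelDecayOfRecord₁₃ {κ : ℝ} (h : ∀ μ ν : Fin 4, KernelDecayOfRecord₁₃ F N θ μ ν κ) {g₀ : ℕ → ℝ} (hg₀ : g₀ ∈ Window θ.γ) :
    ∃ C₀ : ℝ, 0 ≤ C₀ ∧ ∀ (U : (u3OfRecord₁₃ θ (objectsOfRecord₁₃ F N θ ℓ) k).C.BgA) (X : (u3OfRecord₁₃ θ (objectsOfRecord₁₃ F N θ ℓ) k).C.Dom),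
      |(u3OfRecord₁₃ θ (objectsOfRecord₁₃ F N θ ℓ) k).EA g₀ U X| ≤ C₀ * Real.exp (-(κ * (u3OfRecord₁₃ θ (objectsOfRecord₁₃ F N θ ℓ) k).C.d X)) := by
  have h' : ∀ μ ν : Fin 4, ∃ C₀ : ℝ, ∀ k' z,
      |(u3OfRecord₁₃ θ (objectsOfRecord₁₃ F N θ ℓ) k).EA g₀ PUnit.unit (pt k' μ ν z)| ≤ C₀ * Real.exp (-κ * l1 z) := by
    intro μ ν
    obtain ⟨C₀, hC⟩ := (kernelDecayOfRecord₁₃_iff F N θ ℓ k μ ν κ).1 (h μ ν) g₀ hg₀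
    exact ⟨C₀, fun k' z => hC k' z⟩
  choose C₀ hC₀ using h'
  refine ⟨∑ μ, ∑ ν, |C₀ μ ν|, Finset.sum_nonneg fun _ _ => Finset.sum_nonneg fun _ _ => abs_nonneg _, ?_⟩
  rintro U ⟨k', μ, ν, z⟩
  have h1 := hC₀ μ ν k' z
  rw [neg_mul] at h1
  have hle : C₀ μ ν ≤ ∑ μ', ∑ ν', |C₀ μ' ν'| :=
    (le_abs_self _).trans ((Finset.single_le_sum (f := fun ν' => |C₀ μ ν'|) (fun _ _ => abs_nonneg _) (Finset.mem_univ ν)).trans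
      (Finset.single_le_sum (f := fun μ' => ∑ ν', |C₀ μ' ν'|) (fun _ _ => Finset.sum_nonneg fun _ _ => abs_nonneg _) (Finset.mem_univ μ)))
  exact h1.trans (mul_le_mul_of_nonneg_right hle (Real.exp_pos _).le)

/-- ★ **(T)'s DECAY INPUT AT THE PIN FROM THE (D4) LETTER AT EVERY DIRECTION PAIR AND N22's SLOT** [bookkeeping]: under `∀ μ ν, KernelDecayOfRecord₁₃ F N θ μ ν ℓ.κ`,
`N22At` of the pinned bundle, `0 ≤ ℓ.C₉`, `0 ≤ ℓ.ω < 1`, `0 < θ.γ`: SOME `E₀ ≥ 0` with `DecayBound (pinned EA) (Window θ.γ) E₀ ℓ.κ` — the decay conjunct of the link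
reading's tube block at the record window; by `decayBound_window_mono` on every tuning window `γ' ≤ θ.γ`. [folklore] -/
theorem decayBound_atPin_of_kernelDecayOfRecord₁₃_of_n22At (h : ∀ μ ν : Fin 4, KernelDecayOfRecord₁₃ F N θ μ ν ℓ.κ)
    (h22 : N22At (u3OfRecord₁₃ θ (objectsOfRecord₁₃ F N θ ℓ) k)) (hC₉ : 0 ≤ ℓ.C₉) (hω0 : 0 ≤ ℓ.ω) (hω1 : ℓ.ω < 1) (hγ : 0 < θ.γ) :
    ∃ E₀ : ℝ, 0 ≤ E₀ ∧ DecayBound (u3OfRecord₁₃ θ (objectsOfRecord₁₃ F N θ ℓ) k).EA (Window θ.γ) E₀ ℓ.κ := by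
  -- the constant history `γ` lies in the window
  have hg₀ : (fun _ => θ.γ) ∈ Window θ.γ := fun _ => ⟨hγ, le_rfl⟩
  obtain ⟨C₀, hC₀, href⟩ := refDecay_atPin_of_kernelDecayOfRecord₁₃ θ ℓ k h hg₀
  refine ⟨C₀ + ℓ.C₉ * θ.γ * (ℓ.ω / (1 - ℓ.ω)), ?_, ?_⟩
  · exact add_nonneg hC₀ (mul_nonneg (mul_nonneg hC₉ hγ.le) (div_nonneg hω0 (by linarith)))
  · exact decayBound_of_refDecay_of_ne9_fading _ subset_rfl hγ.le hg₀ href ((n22At_atPin_iff θ ℓ k).1 h22).1 ((n22At_atPin_iff θ ℓ k).1 h22).2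
      hC₉ hω0 hω1

/-- ★ **AT THE PIN, MODULO N22's SLOT AND THE LETTER SIGNS: (T)'s DECAY INPUT ⟺ THE (D4) LETTER AT EVERY DIRECTION PAIR** [bookkeeping] (⟹ FILE 2's
`kernelDecayOfRecord₁₃_of_decayBound`; ⟸ above). [folklore] -/
theorem decayBound_atPin_iff_kernelDecayOfRecord₁₃ (h22 : N22At (u3OfRecord₁₃ θ (objectsOfRecord₁₃ F N θ ℓ) k)) (hC₉ : 0 ≤ ℓ.C₉) (hω0 : 0 ≤ ℓ.ω)
    (hω1 : ℓ.ω < 1) (hγ : 0 < θ.γ) :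
    (∃ E₀ : ℝ, 0 ≤ E₀ ∧ DecayBound (u3OfRecord₁₃ θ (objectsOfRecord₁₃ F N θ ℓ) k).EA (Window θ.γ) E₀ ℓ.κ) ↔
      ∀ μ ν : Fin 4, KernelDecayOfRecord₁₃ F N θ μ ν ℓ.κ :=
  ⟨fun ⟨_, _, h⟩ μ ν => kernelDecayOfRecord₁₃_of_decayBound θ ℓ k h μ ν,
    fun h => decayBound_atPin_of_kernelDecayOfRecord₁₃_of_n22At θ ℓ k h h22 hC₉ hω0 hω1 hγ⟩

/-- On every tuning window `γ' ≤ θ.γ` the same decay input. [folklore] -/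
theorem decayBound_atPin_tuningWindow (h : ∀ μ ν : Fin 4, KernelDecayOfRecord₁₃ F N θ μ ν ℓ.κ)
    (h22 : N22At (u3OfRecord₁₃ θ (objectsOfRecord₁₃ F N θ ℓ) k)) (hC₉ : 0 ≤ ℓ.C₉) (hω0 : 0 ≤ ℓ.ω) (hω1 : ℓ.ω < 1) (hγ : 0 < θ.γ) {γ' : ℝ}
    (hγ' : γ' ≤ θ.γ) :
    ∃ E₀ : ℝ, 0 ≤ E₀ ∧ DecayBound (u3OfRecord₁₃ θ (objectsOfRecord₁₃ F N θ ℓ) k).EA (Window γ') E₀ ℓ.κ := by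
  obtain ⟨E₀, hE₀, hd⟩ := decayBound_atPin_of_kernelDecayOfRecord₁₃_of_n22At θ ℓ k h h22 hC₉ hω0 hω1 hγ
  exact ⟨E₀, hE₀, decayBound_window_mono _ (window_mono hγ') hd⟩

end AtPin

/-! ## §3 Under the pin equation, at the reading's bundle -/

section Pinned

variable {N : ℕ} [NeZero N] (𝔯 : RateReading₁₃CoPH N) {F : T4Family} (θ : Stage13HParams F N) (hP : θ.Provisos₁₃CoPH F N) (g₀ : ℕ → ℝ)
  (os : List (ULoop F)) (ℓ : U3Letters₁₁) (hpin : (𝔯.lit F θ hP g₀ os).u3 = objectsOfRecord₁₃ F N θ.toStage13Params ℓ) (k : ℕ)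

include hpin

/-- ★ **AT THE READING UNDER THE PIN: (T)'s DECAY ON EVERY TUNING WINDOW FROM THE (D4) LETTER (∀ μν) AND THE BUNDLE's N22 SLOT** [bookkeeping]. [folklore] -/
theorem decayBound_rateCarriersOfRecord₁₃CoPH_of_pin (h : ∀ μ ν : Fin 4, KernelDecayOfRecord₁₃ F N θ.toStage13Params μ ν ℓ.κ)
    (h22 : N22At (rateCarriersOfRecord₁₃CoPH 𝔯 F θ hP g₀ os k).u3) (hC₉ : 0 ≤ ℓ.C₉) (hω0 : 0 ≤ ℓ.ω) (hω1 : ℓ.ω < 1) (hγ : 0 < θ.γ)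
    {γ' : ℝ} (hγ' : γ' ≤ θ.γ) :
    ∃ E₀ : ℝ, 0 ≤ E₀ ∧ DecayBound (rateCarriersOfRecord₁₃CoPH 𝔯 F θ hP g₀ os k).u3.EA (Window γ') E₀ (rateCarriersOfRecord₁₃CoPH 𝔯 F θ hP g₀ os k).u3.κ := by
  rw [u3_rateCarriersOfRecord₁₃CoPH_of_pin 𝔯 θ hP g₀ os ℓ hpin k] at h22 ⊢
  exact decayBound_atPin_tuningWindow _ ℓ k h h22 hC₉ hω0 hω1 hγ hγ'

end Pinned

end Summit.QuantumFields.YangMills.BalabanUVNodes.N19TubeDecayAtU3PinFromLetters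

end
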